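import Mathlib
import HarnessLib
import Literature.NumberTheory.Transcendental.KZMonomialCompression
import Summits.KontsevichZagierPeriods.KontsevichZagierPeriods.Theorems.LinRedNormalFormArrangementNormalFormStubIntegrateOut

/-!
# `stub_integrateOutPrime` (crux `ArrangementNormalForm`, line `janus-bands`)

`GI b k → closure (JD (b + k))`: as the landed `stub_integrateOut`, but the fibre letters
`tᵢ − cᵢ(x', y)` and the affine fibre bounds may involve the distinguished base coordinate `y`.
Relabel so that `y` is last (`IntegrateOut.eqv`) and SHEAR the fibres, `tᵢ' = tᵢ − αᵢ y` with
`αᵢ` the `y`-coefficient of the letter `cᵢ` (rule 2, a unipotent linear substitution, Jacobian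
`1`: `shear_rep`); afterwards every letter is `y`-free and joins the denominators
(`integrand_shear`), and every domain constraint is a strict affine inequality in `(x', t', y)`,
i.e. a `y`-free row, a lower or an upper bound of `y` (`rows_flat_iff`, `mem_shear_iff`). Then
`y` is integrated out by the landed `IntegrateOut.flat_pole` / `IntegrateOut.flat_poly`; every
piece lands in `JJ (b + k) 0 ⊆ JD (b + k)`. [Kontsevich–Zagier 2001, §1.2, rules (1)–(3)]
-/

noncomputable section

open Set MeasureTheory
open Literature.NumberTheory.Transcendental
open Literature.ModelTheory.ExponentialFields

namespace Summit.KontsevichZagierPeriods.ArrangementNormalForm.JanusBands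

namespace IntegrateOutPrime

open IntegrateOut

/-- Appending a `y`-coefficient `γ` to an affine datum `P` over the flat coordinates.
[folklore] -/
def snocD {B : ℕ} (P : (Fin B → ℚ) × ℚ) (γ : ℚ) : (Fin (B + 1) → ℚ) × ℚ := (Fin.snoc P.1 γ, P.2)

/-- `snocD P γ` evaluates to `P(init w) + γ · w last`. [folklore] -/
@[simp] theorem ev_snocD {B : ℕ} (P : (Fin B → ℚ) × ℚ) (γ : ℚ) (w : Fin (B + 1) → ℝ) :
    ev (snocD P γ) w = ev P (Fin.init w) + (γ : ℝ) * w (Fin.last B) := by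
  simp only [ev, snocD, Fin.sum_univ_castSucc, Fin.snoc_castSucc, Fin.snoc_last, Fin.init]
  ring

/-- The `y`-free rows of a finite set of affine rows over `(x, y)`. [folklore] -/
def ZR {B : ℕ} (Rows : Finset ((Fin (B + 1) → ℚ) × ℚ)) : Finset ((Fin B → ℚ) × ℚ) :=
  (Rows.filter fun C => C.1 (Fin.last B) = 0).image restr

/-- The rows with positive `y`-coefficient, solved for `y` (lower bounds of `y`). [folklore] -/
def LW {B : ℕ} (Rows : Finset ((Fin (B + 1) → ℚ) × ℚ)) : Finset ((Fin B → ℚ) × ℚ) :=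
  (Rows.filter fun C => 0 < C.1 (Fin.last B)).image nrm

/-- The rows with negative `y`-coefficient, solved for `y` (upper bounds of `y`). [folklore] -/
def UP {B : ℕ} (Rows : Finset ((Fin (B + 1) → ℚ) × ℚ)) : Finset ((Fin B → ℚ) × ℚ) :=
  (Rows.filter fun C => C.1 (Fin.last B) < 0).image nrm

/-- **A finite system of strict affine inequalities in `(x, y)`, solved for `y`**: `x` lies in
the polytope of the `y`-free rows and `y` lies strictly between the lower bounds `LW` and the
upper bounds `UP`. [folklore] -/
theorem rows_flat_iff {B : ℕ} (Rows : Finset ((Fin (B + 1) → ℚ) × ℚ)) (w : Fin (B + 1) → ℝ) :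
    (∀ C ∈ Rows, 0 < ev C w) ↔
      ((Fin.init w : Fin B → ℝ) ∈ poly B (ZR Rows) ∧
        (∀ P ∈ LW Rows, ev P (Fin.init w) < w (Fin.last B)) ∧
        ∀ S ∈ UP Rows, w (Fin.last B) < ev S (Fin.init w)) := by
  constructor
  · intro h
    refine ⟨fun P hP => ?_, fun P hP => ?_, fun P hP => ?_⟩ <;>
      obtain ⟨C, hC, rfl⟩ := Finset.mem_image.mp hP <;>
      obtain ⟨hC, h0⟩ := Finset.mem_filter.mp hC
    · exact ((row_iff C w).mp (h C hC)).1 h0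
    · exact ((row_iff C w).mp (h C hC)).2.1 h0
    · exact ((row_iff C w).mp (h C hC)).2.2 h0
  · rintro ⟨h1, h2, h3⟩ C hC
    exact (row_iff C w).mpr
      ⟨fun h0 => h1 _ (Finset.mem_image_of_mem _ (Finset.mem_filter.mpr ⟨hC, h0⟩)),
       fun h0 => h2 _ (Finset.mem_image_of_mem _ (Finset.mem_filter.mpr ⟨hC, h0⟩)),
       fun h0 => h3 _ (Finset.mem_image_of_mem _ (Finset.mem_filter.mpr ⟨hC, h0⟩))⟩

/-- Undoing the shear: `w ↦ (w l + β l · w last)ₗ`. [folklore] -/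
def unshear {N : ℕ} (β : Fin (N + 1) → ℚ) (w : Fin (N + 1) → ℝ) : Fin (N + 1) → ℝ :=
  fun l => w l + (β l : ℝ) * w (Fin.last N)

/-- The shear: `z ↦ (z l − β l · z last)ₗ`. [folklore] -/
def shear {N : ℕ} (β : Fin (N + 1) → ℚ) (z : Fin (N + 1) → ℝ) : Fin (N + 1) → ℝ :=
  fun l => z l - (β l : ℝ) * z (Fin.last N)

variable {N : ℕ} (β : Fin (N + 1) → ℚ) (hβ : β (Fin.last N) = 0)
include hβ

/-- `shear ∘ unshear = id` (the last coordinate is not sheared). [folklore] -/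
theorem shear_unshear (w : Fin (N + 1) → ℝ) : shear β (unshear β w) = w := by
  funext l
  simp [shear, unshear, hβ]

/-- `unshear ∘ shear = id`. [folklore] -/
theorem unshear_shear (z : Fin (N + 1) → ℝ) : unshear β (shear β z) = z := by
  funext l
  simp [shear, unshear, hβ]

omit hβ in
/-- The matrix of the shear. [folklore] -/
def shMat : Matrix (Fin (N + 1)) (Fin (N + 1)) ℝ :=
  1 - Matrix.of fun l l' => if l' = Fin.last N then (β l : ℝ) else 0

/-- The shear matrix is unipotent upper triangular: determinant `1`. [folklore] -/
theorem det_shMat : (shMat β).det = 1 := by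
  have htri : (shMat β).BlockTriangular id := by
    intro i j hij
    have hj : j ≠ Fin.last N := fun h => (h ▸ (id hij : j < i)).not_ge (Fin.le_last i)
    have hij' : i ≠ j := fun h => (h ▸ (id hij : j < i)).false
    simp [shMat, hij', hj]
  rw [Matrix.det_of_upperTriangular htri]
  refine Finset.prod_eq_one fun i _ => ?_
  by_cases hi : i = Fin.last N
  · subst hi
    simp [shMat, hβ]
  · simp [shMat, hi]

/-- **The shear is a move** (rule 2, a unipotent linear change of variables): for a
representation `r₁` on `ℝ^{N+1}` there is a representation `r₀` on the sheared domain
`{w | unshear w ∈ r₁.domain}` with integrand `r₁.integrand ∘ unshear` (Jacobian `1`), bounded if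
`r₁.domain` is, and `[r₁] − [r₀] ∈ KZ.relations`. [Kontsevich–Zagier 2001, §1.2, rule (2)] -/
theorem shear_rep (r₁ : KZ.IntegralRep (N + 1)) :
    ∃ r₀ : KZ.IntegralRep (N + 1), r₀.domain = {w | unshear β w ∈ r₁.domain} ∧
      (r₀.integrand = fun w => r₁.integrand (unshear β w)) ∧
      (Bornology.IsBounded r₁.domain → Bornology.IsBounded r₀.domain) ∧
      KZ.of r₁ - KZ.of r₀ ∈ KZ.relations := by
  set D₀ : Set (Fin (N + 1) → ℝ) := {w | unshear β w ∈ r₁.domain}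
  -- polynomial descriptions of `unshear` and `shear`
  set unP : Fin (N + 1) → MvPolynomial (Fin (N + 1)) ℚ :=
    fun l => MvPolynomial.X l + MvPolynomial.C (β l) * MvPolynomial.X (Fin.last N) with hunP_def
  set shP : Fin (N + 1) → MvPolynomial (Fin (N + 1)) ℚ :=
    fun l => MvPolynomial.X l - MvPolynomial.C (β l) * MvPolynomial.X (Fin.last N) with hshP_def
  have hunP (w : Fin (N + 1) → ℝ) : (fun l => MvPolynomial.aeval w (unP l)) = unshear β w := by
    funext l; simp [hunP_def, unshear]
  have hshP (z : Fin (N + 1) → ℝ) : (fun l => MvPolynomial.aeval z (shP l)) = shear β z := by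
    funext l; simp [hshP_def, shear]
  have hD₀sa : IsSemialgebraic ℚ D₀ := by
    convert r₁.isSemialgebraic_domain.preimage_aeval unP using 1
    exact Set.ext fun w => by rw [mem_preimage, hunP]; rfl
  have hunsa : IsSemialgebraicMapOn ℚ D₀ (unshear β) :=
    (isSemialgebraicMapOn_aeval hD₀sa unP).congr fun w _ => hunP w
  have hf₀sa : IsSemialgebraicFunOn ℚ D₀ (fun w => r₁.integrand (unshear β w)) :=
    IsSemialgebraicFunOn.comp_isSemialgebraicMapOn_holds r₁.isSemialgebraicFunOn_integrand
      hunsa fun w hw => hw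
  -- the linear map
  set Lin : (Fin (N + 1) → ℝ) →L[ℝ] (Fin (N + 1) → ℝ) :=
    LinearMap.toContinuousLinearMap (Matrix.toLin' (shMat β)) with hLin
  have hΦ : ∀ z, Lin z = shear β z := fun z => by
    rw [hLin, LinearMap.coe_toContinuousLinearMap', Matrix.toLin'_apply, shMat, Matrix.sub_mulVec,
      Matrix.one_mulVec]
    funext l
    simp [Matrix.mulVec, dotProduct, shear, ite_mul]
  have hdet : Lin.det = 1 := by
    rw [hLin, ContinuousLinearMap.det, LinearMap.coe_toContinuousLinearMap, LinearMap.det_toLin',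
      det_shMat β hβ]
  have himage : Lin '' r₁.domain = D₀ := by
    refine Set.ext fun w => ⟨?_, fun hw => ⟨unshear β w, hw, by rw [hΦ, shear_unshear β hβ]⟩⟩
    rintro ⟨z, hz, rfl⟩
    show unshear β (Lin z) ∈ r₁.domain
    rwa [hΦ, unshear_shear β hβ]
  have hderiv : ∀ z ∈ r₁.domain, HasFDerivWithinAt (⇑Lin) Lin r₁.domain z := fun z _ =>
    Lin.hasFDerivAt.hasFDerivWithinAt
  have hinj : InjOn (⇑Lin) r₁.domain := fun z _ z' _ h => by
    rw [← unshear_shear β hβ z, ← unshear_shear β hβ z', ← hΦ, ← hΦ, h]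
  have hmeas : MeasurableSet r₁.domain := KZ.IntegralRep.measurableSet_domain_holds r₁
  have hf₀int : IntegrableOn (fun w => r₁.integrand (unshear β w)) D₀ := by
    rw [← himage, integrableOn_image_iff_integrableOn_abs_det_fderiv_smul volume hmeas hderiv hinj]
    refine r₁.integrableOn.congr_fun (fun z _ => ?_) hmeas
    rw [smul_eq_mul, hdet, hΦ, unshear_shear β hβ, abs_one, one_mul]
  let r₀ : KZ.IntegralRep (N + 1) := ⟨D₀, fun w => r₁.integrand (unshear β w), hD₀sa, hf₀sa, hf₀int⟩
  have hLinsa : IsSemialgebraicMapOn ℚ r₁.domain ⇑Lin :=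
    (isSemialgebraicMapOn_aeval r₁.isSemialgebraic_domain shP).congr fun z _ => by
      beta_reduce
      rw [hshP, hΦ]
  have hcov : KZ.of r₁ - KZ.of r₀ ∈ KZ.relations :=
    KZ.changeOfVariablesRel_subset_relations
      (KZ.of_sub_of_mem_changeOfVariablesRel_linear r₁ r₀ Lin hLinsa hinj himage.symm
        fun z _ => by
          show r₁.integrand z = r₁.integrand (unshear β (Lin z)) * |Lin.det|
          rw [hΦ, unshear_shear β hβ, hdet, abs_one, mul_one])
  refine ⟨r₀, rfl, rfl, fun hbd => ?_, hcov⟩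
  show Bornology.IsBounded D₀
  rw [← himage]
  exact Lin.lipschitz.isBounded_image hbd

omit hβ

variable {b k m m' : ℕ}

/-- The shear coefficients of a `GI b k` representation in flat coordinates: `αᵢ` on the fibre
coordinate `tᵢ`, `0` on the base coordinates `x'` and on `y`. [folklore] -/
def bvec (b : ℕ) {k : ℕ} (α : Fin k → ℚ) : Fin (b + k + 1) → ℚ :=
  Fin.snoc (Fin.append (0 : Fin b → ℚ) α) 0

/-- `bvec` vanishes on `y`. [folklore] -/
@[simp] theorem bvec_last (α : Fin k → ℚ) : bvec b α (Fin.last (b + k)) = 0 := by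
  simp [bvec]

/-- Unshearing does not move the base coordinates. [folklore] -/
theorem unshear_x (α : Fin k → ℚ) (w : Fin (b + k + 1) → ℝ) (j : Fin b) :
    unshear (bvec b α) w (Fin.castSucc (Fin.castAdd k j)) = w (Fin.castSucc (Fin.castAdd k j)) := by
  simp only [unshear, bvec, Fin.snoc_castSucc, Fin.append_left, Pi.zero_apply, Rat.cast_zero,
    zero_mul, add_zero]

/-- Unshearing does not move `y`. [folklore] -/
theorem unshear_last (α : Fin k → ℚ) (w : Fin (b + k + 1) → ℝ) :
    unshear (bvec b α) w (Fin.last (b + k)) = w (Fin.last (b + k)) := by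
  simp only [unshear, bvec_last, Rat.cast_zero, zero_mul, add_zero]

/-- Unshearing a fibre coordinate: `tᵢ = tᵢ' + αᵢ y`. [folklore] -/
theorem unshear_t (α : Fin k → ℚ) (w : Fin (b + k + 1) → ℝ) (i : Fin k) :
    unshear (bvec b α) w (Fin.castSucc (Fin.natAdd b i)) =
      w (Fin.castSucc (Fin.natAdd b i)) + (α i : ℝ) * w (Fin.last (b + k)) := by
  simp only [unshear, bvec, Fin.snoc_castSucc, Fin.append_right]

/-- An affine function of the base `(x', y)` as a row over the flat coordinates `(x', t', y)`.
[folklore] -/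
def liftC (k : ℕ) (c : (Fin (b + 1) → ℚ) × ℚ) : (Fin (b + k + 1) → ℚ) × ℚ :=
  snocD (pad k (restr c)) (c.1 (Fin.last b))

/-- The lifted row evaluates to the base form at the unsheared point. [folklore] -/
theorem ev_liftC (α : Fin k → ℚ) (c : (Fin (b + 1) → ℚ) × ℚ) (w : Fin (b + k + 1) → ℝ) :
    (∑ i, (c.1 i : ℝ) * unshear (bvec b α) w (eqv b k (Fin.castAdd k i)) + (c.2 : ℝ)) =
      ev (liftC k c) w := by
  change ev c (fun i => unshear (bvec b α) w (eqv b k (Fin.castAdd k i))) = _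
  rw [ev_succ, liftC, ev_snocD, ev_pad]
  simp only [eqv_x, eqv_y, unshear_x, unshear_last, Fin.init]

/-- The value forms of the fibre bounds in sheared flat coordinates: a fibre `tⱼ = tⱼ' + αⱼ y`
or a lifted base form. [folklore] -/
def vform (k : ℕ) (α : Fin k → ℚ) (u : Fin k ⊕ ((Fin (b + 1) → ℚ) × ℚ)) :
    (Fin (b + k + 1) → ℚ) × ℚ :=
  Sum.elim (fun j => snocD (crd b j) (α j)) (fun c => liftC k c) u

/-- A fibre coordinate at the unsheared point is its value form. [folklore] -/
theorem unshear_t_eq_ev (α : Fin k → ℚ) (w : Fin (b + k + 1) → ℝ) (i : Fin k) :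
    unshear (bvec b α) w (eqv b k (Fin.natAdd (b + 1) i)) = ev (vform k α (Sum.inl i)) w := by
  rw [eqv_t, unshear_t, vform, Sum.elim_inl, ev_snocD, ev_crd]
  rfl

/-- A fibre bound at the unsheared point is its value form. [folklore] -/
theorem elim_eq_ev (α : Fin k → ℚ) (w : Fin (b + k + 1) → ℝ)
    (u : Fin k ⊕ ((Fin (b + 1) → ℚ) × ℚ)) :
    Sum.elim (fun j => unshear (bvec b α) w (eqv b k (Fin.natAdd (b + 1) j)))
        (fun c => ∑ i', (c.1 i' : ℝ) * unshear (bvec b α) w (eqv b k (Fin.castAdd k i')) +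
          (c.2 : ℝ)) u = ev (vform k α u) w := by
  rcases u with j | c
  · exact unshear_t_eq_ev α w j
  · rw [Sum.elim_inr, ev_liftC]
    rfl

/-- All domain constraints of a `GI b k` representation as strict affine rows over the sheared
flat coordinates: the base rows and, for each fibre, `lo < t` and `t < hi`. [folklore] -/
def rows (k : ℕ) (M : Fin m' → (Fin (b + 1) → ℚ) × ℚ) (α : Fin k → ℚ)
    (lo hi : Fin k → Fin k ⊕ ((Fin (b + 1) → ℚ) × ℚ)) : Finset ((Fin (b + k + 1) → ℚ) × ℚ) :=
  Finset.univ.image (fun j => liftC k (M j)) ∪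
    (Finset.univ.image (fun i => vform k α (Sum.inl i) - vform k α (lo i)) ∪
      Finset.univ.image (fun i => vform k α (hi i) - vform k α (Sum.inl i)))

/-- **The `GI b k` domain in sheared flat coordinates** is cut out by the rows `rows k M α lo hi`.
[folklore] -/
theorem mem_shear_iff (M : Fin m' → (Fin (b + 1) → ℚ) × ℚ) (α : Fin k → ℚ)
    (lo hi : Fin k → Fin k ⊕ ((Fin (b + 1) → ℚ) × ℚ)) (w : Fin (b + k + 1) → ℝ) :
    (fun i => unshear (bvec b α) w (eqv b k i)) ∈ {z : Fin (b + 1 + k) → ℝ |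
      (∀ j, 0 < ∑ i, ((M j).1 i : ℝ) * z (Fin.castAdd k i) + ((M j).2 : ℝ)) ∧
      ∀ i, Sum.elim (fun j => z (Fin.natAdd (b + 1) j))
          (fun c => ∑ i', (c.1 i' : ℝ) * z (Fin.castAdd k i') + (c.2 : ℝ)) (lo i) <
          z (Fin.natAdd (b + 1) i) ∧
        z (Fin.natAdd (b + 1) i) < Sum.elim (fun j => z (Fin.natAdd (b + 1) j))
          (fun c => ∑ i', (c.1 i' : ℝ) * z (Fin.castAdd k i') + (c.2 : ℝ)) (hi i)} ↔
    ∀ C ∈ rows k M α lo hi, 0 < ev C w := by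
  simp only [mem_setOf_eq]
  simp only [elim_eq_ev]
  simp only [ev_liftC, unshear_t_eq_ev]
  simp only [rows, Finset.forall_mem_union, Finset.forall_mem_image, Finset.mem_univ,
    true_imp_iff, ev_sub, sub_pos, forall_and]

/-- The `y`-coefficients of the fibre letters (`0` for a letter-free fibre). [folklore] -/
def lcoef (a : Fin k → Option ((Fin (b + 1) → ℚ) × ℚ)) : Fin k → ℚ :=
  fun i => (a i).elim 0 (fun c => c.1 (Fin.last b))

/-- **The `GI b k` integrand in sheared flat coordinates**: after the shear by the letter
coefficients every letter is `y`-free, `tᵢ − cᵢ(x', y) = tᵢ' − (restr cᵢ)(x')`, and the letters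
join the denominator of the rational factor. [folklore] -/
theorem integrand_shear (L : Fin m → (Fin b → ℚ) × ℚ) (e : Fin m → ℕ)
    (p : MvPolynomial (Fin b) ℚ) (ℓ₁ ℓ₂ : (Fin b → ℚ) × ℚ) (n₁ n₂ : ℕ)
    (a : Fin k → Option ((Fin (b + 1) → ℚ) × ℚ)) (w : Fin (b + k + 1) → ℝ) :
    (fun z : Fin (b + 1 + k) → ℝ =>
      MvPolynomial.aeval (fun i => z (Fin.castAdd k (Fin.castSucc i))) p /
        (∏ j, (∑ i, ((L j).1 i : ℝ) * z (Fin.castAdd k (Fin.castSucc i)) + ((L j).2 : ℝ)) ^ e j) *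
      ((z (Fin.castAdd k (Fin.last b)) -
          (∑ i, (ℓ₁.1 i : ℝ) * z (Fin.castAdd k (Fin.castSucc i)) + (ℓ₁.2 : ℝ))) ^ n₁ /
        (z (Fin.castAdd k (Fin.last b)) -
          (∑ i, (ℓ₂.1 i : ℝ) * z (Fin.castAdd k (Fin.castSucc i)) + (ℓ₂.2 : ℝ))) ^ n₂) *
      ∏ i, (a i).elim 1 (fun c => 1 / (z (Fin.natAdd (b + 1) i) -
        (∑ i', (c.1 i' : ℝ) * z (Fin.castAdd k i') + (c.2 : ℝ)))))
      (fun i => unshear (bvec b (lcoef a)) w (eqv b k i)) =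
    ratJ (b + k) (m + k) (Lflat k L a) (eflat k e) (MvPolynomial.rename (Fin.castAdd k) p)
        (Fin.init w) *
      ((w (Fin.last (b + k)) - ev (pad k ℓ₁) (Fin.init w)) ^ n₁ /
        (w (Fin.last (b + k)) - ev (pad k ℓ₂) (Fin.init w)) ^ n₂) := by
  have hprod : ∀ i, (a i).elim (1 : ℝ) (fun c => 1 /
      (unshear (bvec b (lcoef a)) w (eqv b k (Fin.natAdd (b + 1) i)) -
        (∑ i', (c.1 i' : ℝ) * unshear (bvec b (lcoef a)) w (eqv b k (Fin.castAdd k i')) +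
          (c.2 : ℝ)))) =
      (ev ((a i).elim ((0 : Fin (b + k) → ℚ), (1 : ℚ)) (fun c => crd b i - pad k (restr c)))
        (Fin.init w))⁻¹ := by
    intro i
    rcases h : a i with _ | c
    · simp [ev]
    · have hα : lcoef a i = c.1 (Fin.last b) := by simp [lcoef, h]
      simp only [Option.elim_some]
      rw [ev_liftC, eqv_t, unshear_t, hα, liftC, ev_snocD, ev_sub, ev_crd, one_div]
      congr 1
      simp only [Fin.init]
      ring
  simp only [hprod]
  simp only [ratJ, Lflat, eflat, Fin.prod_univ_add, Fin.append_left, Fin.append_right, ev_pad,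
    MvPolynomial.aeval_rename, eqv_x, eqv_y, unshear_x, unshear_last, pow_one,
    Finset.prod_inv_distrib]
  simp only [ev, Function.comp_def, Fin.init]
  ring

end IntegrateOutPrime

open IntegrateOutPrime in
/-- **The shear along the last coordinate is a move** (registered sub-goal of
`stub_integrateOutPrime`): `IntegrateOutPrime.shear_rep` restated. -/
theorem integrateOutPrime_shear (N : ℕ) (β : Fin (N + 1) → ℚ) (hβ : β (Fin.last N) = 0) (r₁ : KZ.IntegralRep (N + 1)) : ∃ r₀ : KZ.IntegralRep (N + 1), r₀.domain = {w | IntegrateOutPrime.unshear β w ∈ r₁.domain} ∧ (r₀.integrand = fun w => r₁.integrand (IntegrateOutPrime.unshear β w)) ∧ (Bornology.IsBounded r₁.domain → Bornology.IsBounded r₀.domain) ∧ KZ.of r₁ - KZ.of r₀ ∈ KZ.relations :=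
  shear_rep β hβ r₁

open IntegrateOut IntegrateOutPrime in
/-- **stub_integrateOutPrime** (`GI b k → closure (JD (b + k))`, line `janus-bands`). The
distinguished base coordinate `y` of a separated Janus band representation carries
`(y − ℓ₁(x'))^{n₁}` (`n₂ = 0`) or a pole `(y − ℓ₂(x'))^{-n₂}` of order `n₂ ≥ 2` (`n₁ = 0`); fibre
letters and bounds may involve `y`. Relabel so that `y` is last and shear every lettered fibre by
the `y`-coefficient of its letter (rule 2, Jacobian `1`): then the letters are `y`-free, the
integrand is `ratJ(x', t') · (y-factor)` and the domain is a rational polytope in `(x', t')`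
times the `y`-interval between finitely many affine bounds; integrate `y` out
(`IntegrateOut.flat_pole` / `flat_poly`: rule 1a dissection by the extreme bounds, ONE
Newton–Leibniz move per piece), landing in `JJ (b + k) 0 ⊆ JD (b + k)`.
[Kontsevich–Zagier 2001, §1.2, rules (1)–(3)] -/
theorem stub_integrateOutPrime (JJ : ℕ → ℕ → Set KZ.FormalRep) (GI : ℕ → ℕ → Set KZ.FormalRep) (JD : ℕ → Set KZ.FormalRep) (hJJ : ∀ b k, JJ b k = {w : KZ.FormalRep | ∃ (m m' : ℕ) (s : KZ.IntegralRep (b + k)) (M : Fin m' → (Fin b → ℚ) × ℚ) (L : Fin m → (Fin b → ℚ) × ℚ) (e : Fin m → ℕ) (p : MvPolynomial (Fin b) ℚ) (a : Fin k → Option ((Fin b → ℚ) × ℚ)) (lo hi : Fin k → Fin k ⊕ ((Fin b → ℚ) × ℚ)), Bornology.IsBounded s.domain ∧ s.domain = {z | (∀ j, 0 < ∑ i, ((M j).1 i : ℝ) * z (Fin.castAdd k i) + ((M j).2 : ℝ)) ∧ ∀ i, Sum.elim (fun j => z (Fin.natAdd b j)) (fun c => ∑ i', (c.1 i' : ℝ)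 * z (Fin.castAdd k i') + (c.2 : ℝ)) (lo i) < z (Fin.natAdd b i) ∧ z (Fin.natAdd b i) < Sum.elim (fun j => z (Fin.natAdd b j)) (fun c => ∑ i', (c.1 i' : ℝ) * z (Fin.castAdd k i') + (c.2 : ℝ)) (hi i)} ∧ EqOn s.integrand (fun z => MvPolynomial.aeval (fun i => z (Fin.castAdd k i)) p / (∏ j, (∑ i, ((L j).1 i : ℝ) * z (Fin.castAdd k i) + ((L j).2 : ℝ)) ^ e j) * ∏ i, (a i).elim 1 (fun c => 1 / (z (Fin.natAdd b i) - (∑ i', (c.1 i' : ℝ) * z (Fin.castAdd k i') + (c.2 : ℝ))))) s.domain ∧ w = KZ.of s}) (hGI : ∀ b k, GI b k = {w : KZ.FormalRep | ∃ (m m' n₁ n₂ : ℕ) (s : KZ.IntegralRep (b + 1 + k)) (M : Fin m' → (Fin (b + 1) → ℚ) × ℚ) (L : Fin m → (Fin b → ℚ) × ℚ) (e : Fin m → ℕ) (p : MvPolynomial (Fin b) ℚ) (ℓ₁ ℓ₂ : (Fin b → ℚ) × ℚ) (a : Fin k → Option ((Fin (b + 1) → ℚ) × ℚ)) (lo hi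 : Fin k → Fin k ⊕ ((Fin (b + 1) → ℚ) × ℚ)), (n₁ = 0 ∨ n₂ = 0) ∧ n₂ ≠ 1 ∧ Bornology.IsBounded s.domain ∧ s.domain = {z | (∀ j, 0 < ∑ i, ((M j).1 i : ℝ) * z (Fin.castAdd k i) + ((M j).2 : ℝ)) ∧ ∀ i, Sum.elim (fun j => z (Fin.natAdd (b + 1) j)) (fun c => ∑ i', (c.1 i' : ℝ) * z (Fin.castAdd k i') + (c.2 : ℝ)) (lo i) < z (Fin.natAdd (b + 1) i) ∧ z (Fin.natAdd (b + 1) i) < Sum.elim (fun j => z (Fin.natAdd (b + 1) j)) (fun c => ∑ i', (c.1 i' : ℝ) * z (Fin.castAdd k i') + (c.2 : ℝ)) (hi i)} ∧ EqOn s.integrand (fun z => MvPolynomial.aeval (fun i => z (Fin.castAdd k (Fin.castSucc i))) p / (∏ j, (∑ i, ((L j).1 i : ℝ) * z (Fin.castAdd k (Fin.castSucc i)) + ((L j).2 : ℝ)) ^ e j) * ((z (Fin.castAdd k (Fin.last b)) - (∑ i, (ℓ₁.1 i : ℝ) * z (Fin.castAdd k (Fin.castSucc i)) + (ℓ₁.2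 : ℝ))) ^ n₁ / (z (Fin.castAdd k (Fin.last b)) - (∑ i, (ℓ₂.1 i : ℝ) * z (Fin.castAdd k (Fin.castSucc i)) + (ℓ₂.2 : ℝ))) ^ n₂) * ∏ i, (a i).elim 1 (fun c => 1 / (z (Fin.natAdd (b + 1) i) - (∑ i', (c.1 i' : ℝ) * z (Fin.castAdd k i') + (c.2 : ℝ))))) s.domain ∧ w = KZ.of s}) (hJD : ∀ N, JD N = {w : KZ.FormalRep | ∃ b' k', b' + k' = N ∧ w ∈ JJ b' k'}) (b k : ℕ) : ∀ x ∈ GI b k, ∃ c ∈ AddSubgroup.closure (JD (b + k)), x - c ∈ KZ.relations := by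
  intro x hx
  rw [hGI] at hx
  obtain ⟨m, m', n₁, n₂, s, M, L, e, p, ℓ₁, ℓ₂, a, lo, hi, h12, hn1, hbd, hdom, hint, rfl⟩ := hx
  -- rule 2: `y` last, fibres promoted to base coordinates
  set r₁ := s.reindex (eqv b k) with hr₁
  have h₁ : KZ.of s - KZ.of r₁ ∈ KZ.relations := of_sub_of_reindex_mem_relations s (eqv b k)
  -- rule 2: shear the fibres by the `y`-coefficients of their letters
  obtain ⟨r₀, hr₀d, hr₀f, hr₀bd, h₂⟩ := shear_rep (bvec b (lcoef a)) (bvec_last (lcoef a)) r₁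
  have hmem : ∀ w, w ∈ r₀.domain ↔
      ((Fin.init w : Fin (b + k) → ℝ) ∈ poly (b + k) (ZR (rows k M (lcoef a) lo hi)) ∧
      (∀ P ∈ LW (rows k M (lcoef a) lo hi), ev P (Fin.init w) < w (Fin.last (b + k))) ∧
      ∀ S ∈ UP (rows k M (lcoef a) lo hi), w (Fin.last (b + k)) < ev S (Fin.init w)) := by
    intro w
    rw [hr₀d, mem_setOf_eq, hr₁, KZ.IntegralRep.reindex_domain, mem_setOf_eq, hdom, mem_shear_iff,
      rows_flat_iff]
  have hr₀b : Bornology.IsBounded r₀.domain :=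
    hr₀bd (by rw [hr₁, KZ.IntegralRep.reindex_domain]; exact isBounded_reindex hbd (eqv b k))
  have hr₀i : ∀ w ∈ r₀.domain, r₀.integrand w =
      ratJ (b + k) (m + k) (Lflat k L a) (eflat k e) (MvPolynomial.rename (Fin.castAdd k) p)
        (Fin.init w) *
      ((w (Fin.last (b + k)) - ev (pad k ℓ₁) (Fin.init w)) ^ n₁ /
        (w (Fin.last (b + k)) - ev (pad k ℓ₂) (Fin.init w)) ^ n₂) := by
    intro w hw
    have hw' : (fun i => unshear (bvec b (lcoef a)) w (eqv b k i)) ∈ s.domain := by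
      rw [hr₀d, mem_setOf_eq, hr₁, KZ.IntegralRep.reindex_domain] at hw
      exact hw
    simp only [hr₀f, hr₁, KZ.IntegralRep.reindex_integrand]
    rw [hint hw']
    exact integrand_shear L e p ℓ₁ ℓ₂ n₁ n₂ a w
  have hsub : JJ0 (b + k) ⊆ JD (b + k) := fun w hw => by
    rw [hJD]
    exact ⟨b + k, 0, rfl, by rw [hJJ]; exact hw⟩
  have key : ∃ c ∈ AddSubgroup.closure (JJ0 (b + k)), KZ.of r₀ - c ∈ KZ.relations := by
    rcases n₂ with _ | _ | n'
    · exact flat_poly r₀ _ _ _ (Lflat k L a) (eflat k e) (MvPolynomial.rename (Fin.castAdd k) p)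
        (pad k ℓ₁) n₁ hmem (fun w hw => by rw [hr₀i w hw]; simp [intP]) hr₀b
    · exact absurd rfl hn1
    · obtain rfl : n₁ = 0 := by omega
      exact flat_pole r₀ _ _ _ (Lflat k L a) (eflat k e) (MvPolynomial.rename (Fin.castAdd k) p)
        (pad k ℓ₂) n' hmem (fun w hw => by rw [hr₀i w hw]; simp [intG]) hr₀b
  obtain ⟨c, hc, hrel⟩ := key
  refine ⟨c, AddSubgroup.closure_mono hsub hc, ?_⟩
  have : KZ.of s - c = (KZ.of s - KZ.of r₁) + (KZ.of r₁ - KZ.of r₀) + (KZ.of r₀ - c) := by abel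
  rw [this]
  exact KZ.relations.add_mem (KZ.relations.add_mem h₁ h₂) hrel

end Summit.KontsevichZagierPeriods.ArrangementNormalForm.JanusBands
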